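import Summits.QuantumFields.YangMills.Theorems.F4SubCurvatureDoorAngularContinuationCharts
import HarnessLib

/-!
# Registered stub (A) «ANGULAR CONTINUATION» of LINE g20-A «angular type» (crux ⟨stmt-QuantumFields-23035⟩
# `F4SubCurvatureDoor.ShortRootRigidity`), BY NAME

Free-hands work of width seat `ym-line-sfw-p2-w3` (g37, cell `ym-idea-1`).  The gluing argument is in
`F4SubCurvatureDoorAngularContinuationCharts` (registered texts `mk2`/`polar`/`fwdTube`/`PlanarSpectralCone`/`AngularContinuation`
restated character-for-character there, chart points, `ε`-consistency, strips); this file assembles the entire `π/3`-periodic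
continuation `G` (nearest-direction chart, identity theorem on the convex strip overlaps, periodicity by the identity theorem on `ℂ`,
growth from the cone majorant and the class budget `‖y‖⁶k → 0`) and proves `stub_angularContinuation` with the registered signature.
HONEST LABEL: the M stub of a PASSed line; (C) `PlanarSpectralCone` (XL) untouched; no crux, rung, leaf or summit is proved; the
Yang–Mills mass gap is NOT proved by this.
-/

noncomputable section

namespace Summit.QuantumFields.YangMills.Cruxes.ShortRootRigidity.AngularType

open Complex Filter Set Metric Function
open scoped Topology Real
open Literature.MathematicalPhysics.QuantumLattice (timeReflection timeReflection_apply)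
open Summit.QuantumFields.YangMills.Theorems.F4SubCurvatureDoorSliceDensityRegistered (E2)
open Summit.QuantumFields.YangMills.Theorems.F4SubCurvatureDoorSliceInClassRegistered (hexReflection InPlanarClass)

/-! ## The stub -/

open Summit.QuantumFields.YangMills.Cruxes.ShortRootRigidity.AngularType renaming PlanarSpectralConeFrame → PlanarSpectralCone

open AngularChartA in
/-- **Registered stub (A) «ANGULAR CONTINUATION», BY NAME AND SIGNATURE**: for a kernel of the planar class, the frame
spectral cone (C) makes the angular trace on every circle the restriction of an entire `π/3`-periodic function of little-o
exponential type `6`. [folklore] -/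
theorem stub_angularContinuation : ∀ k : E2 → ℝ, InPlanarClass k → PlanarSpectralCone k → AngularContinuation k := by
  intro k hk hcone r hr
  -- non-dependent choice of the cone charts
  have hc : ∀ ε : ℝ, ∃ F : ℂ × ℂ → ℂ, 0 < ε → (DifferentiableOn ℂ F fwdTube ∧
      (∀ t b : ℝ, 0 < t → F ((t : ℂ), (b : ℂ)) = k (mk2 (ε + t) b)) ∧
      ∀ w ∈ fwdTube, ‖F w‖ ≤ k (mk2 (ε + (w.1.re - |w.2.im|)) 0)) := by
    intro ε
    by_cases h : 0 < ε
    · obtain ⟨F, hF⟩ := hcone ε h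
      exact ⟨F, fun _ => hF⟩
    · exact ⟨fun _ => 0, fun h' => absurd h' h⟩
  choose F hF using hc
  have hFd : ∀ ε, 0 < ε → DifferentiableOn ℂ (F ε) fwdTube := fun ε hε => (hF ε hε).1
  have hFr : ∀ ε, 0 < ε → ∀ t b : ℝ, 0 < t → F ε ((t : ℂ), (b : ℂ)) = k (mk2 (ε + t) b) :=
    fun ε hε => (hF ε hε).2.1
  have hFb : ∀ ε, 0 < ε → ∀ w ∈ fwdTube, ‖F ε w‖ ≤ k (mk2 (ε + (w.1.re - |w.2.im|)) 0) :=
    fun ε hε => (hF ε hε).2.2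
  -- the chart functions `G_j`
  set Gj : ℤ → ℂ → ℂ := fun j θ => F (shift r θ) (chartPt r j (shift r θ) θ) with hGj
  -- local representation with a FIXED shift
  have hlocal : ∀ (j : ℤ) (θ₀ : ℂ), θ₀ ∈ strip j → ∀ θ : ℂ, θ ∈ strip j → |θ.im - θ₀.im| < 1 →
      Gj j θ = F (r / 16 * Real.exp (-|θ₀.im|)) (chartPt r j (r / 16 * Real.exp (-|θ₀.im|)) θ) := by
    intro j θ₀ _ θ hθ hnear
    have hexp := exp_quarter_lt hnear
    have hε₁pos : 0 < r / 16 * Real.exp (-|θ₀.im|) := by positivity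
    have hle : r / 16 * Real.exp (-|θ₀.im|) ≤ shift r θ := by
      unfold shift; nlinarith [hexp, hr]
    have hw : chartPt r j (shift r θ) θ ∈ fwdTube := chartPt_mem_fwdTube hr hθ (shift_le_half hr θ)
    have hshift := cone_chart_shift hle (hFd _ (shift_pos hr θ)) (hFr _ (shift_pos hr θ)) (hFd _ hε₁pos)
      (hFr _ hε₁pos) hw
    simp only [hGj]
    rw [hshift, chartPt_shift]
  -- holomorphy of `G_j` on its strip
  have hGj_diff : ∀ (j : ℤ) (θ₀ : ℂ), θ₀ ∈ strip j → DifferentiableAt ℂ (Gj j) θ₀ := by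
    intro j θ₀ hθ₀
    have hε₁pos : 0 < r / 16 * Real.exp (-|θ₀.im|) := by positivity
    set V : Set ℂ := strip j ∩ {θ : ℂ | |θ.im - θ₀.im| < 1} with hV
    have hVopen : IsOpen V :=
      (isOpen_strip j).inter (isOpen_lt (continuous_abs.comp (Complex.continuous_im.sub continuous_const)) continuous_const)
    have hθ₀V : θ₀ ∈ V := ⟨hθ₀, by simp⟩
    have hcomp : DifferentiableOn ℂ (fun θ => F (r / 16 * Real.exp (-|θ₀.im|))
        (chartPt r j (r / 16 * Real.exp (-|θ₀.im|)) θ)) V := by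
      refine (hFd _ hε₁pos).comp (differentiable_chartPt r j _).differentiableOn fun θ hθ => ?_
      refine chartPt_mem_fwdTube hr hθ.1 ?_
      have hexp := exp_quarter_lt hθ.2
      nlinarith [hexp, hr]
    have hev : Gj j =ᶠ[𝓝 θ₀] fun θ => F (r / 16 * Real.exp (-|θ₀.im|)) (chartPt r j (r / 16 * Real.exp (-|θ₀.im|)) θ) :=
      Filter.eventuallyEq_of_mem (hVopen.mem_nhds hθ₀V) fun θ hθ => hlocal j θ₀ hθ₀ θ hθ.1 hθ.2
    exact hev.differentiableAt_iff.2 (hcomp.differentiableAt (hVopen.mem_nhds hθ₀V))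
  -- real values of `G_j`
  have hreal : ∀ (j : ℤ) (t : ℝ), (t : ℂ) ∈ strip j → Gj j t = k (polar r t) := by
    intro j t ht
    have hc := half_lt_cos_of_mem_strip ht
    simp only [Complex.ofReal_re] at hc
    have hpos : 0 < r * Real.cos (t - j * (π / 3)) - r / 4 := by nlinarith
    simp only [hGj]
    rw [shift_ofReal, chartPt_ofReal, hFr _ (by positivity) _ _ hpos,
      show r / 4 + (r * Real.cos (t - j * (π / 3)) - r / 4) = r * Real.cos (t - j * (π / 3)) by ring]
    exact_mod_cast InPlanarClass.polar_sub_int hk r t j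
  -- agreement across directions
  have hagree : ∀ (j j' : ℤ) (θ : ℂ), θ ∈ strip j → θ ∈ strip j' → Gj j θ = Gj j' θ := by
    intro j j' θ hθ hθ'
    have hWopen : IsOpen (strip j ∩ strip j') := (isOpen_strip j).inter (isOpen_strip j')
    have hWconn : IsPreconnected (strip j ∩ strip j') := ((convex_strip j).inter (convex_strip j')).isPreconnected
    refine eqOn_of_eq_on_real hWopen hWconn (fun z hz => (hGj_diff j z hz.1).differentiableWithinAt)
      (fun z hz => (hGj_diff j' z hz.2).differentiableWithinAt) ⟨ofReal_re_mem_strip hθ, ofReal_re_mem_strip hθ'⟩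
      (fun t ht => ?_) ⟨hθ, hθ'⟩
    rw [hreal j t ht.1, hreal j' t ht.2]
  -- the global function
  set G : ℂ → ℂ := fun θ => Gj (round (θ.re / (π / 3))) θ with hG
  have hG_eq : ∀ (j : ℤ) (θ : ℂ), θ ∈ strip j → G θ = Gj j θ :=
    fun j θ hθ => hagree _ _ θ (mem_strip_round θ) hθ
  have hG_diff : Differentiable ℂ G := by
    intro θ₀
    have hev : G =ᶠ[𝓝 θ₀] Gj (round (θ₀.re / (π / 3))) :=
      Filter.eventuallyEq_of_mem ((isOpen_strip _).mem_nhds (mem_strip_round θ₀)) fun θ hθ => hG_eq _ θ hθ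
    exact hev.differentiableAt_iff.2 (hGj_diff _ θ₀ (mem_strip_round θ₀))
  have hG_real : ∀ φ : ℝ, G φ = k (polar r φ) := fun φ => by
    rw [hG_eq _ _ (mem_strip_round (φ : ℂ))]
    exact hreal _ φ (mem_strip_round (φ : ℂ))
  -- periodicity
  have hG_per : ∀ z : ℂ, G (z + ((Real.pi / 3 : ℝ) : ℂ)) = G z := by
    have h := eqOn_of_eq_on_real isOpen_univ isPreconnected_univ
      ((hG_diff.comp (differentiable_id.add_const (((Real.pi / 3 : ℝ) : ℂ)))).differentiableOn)
      hG_diff.differentiableOn (x₀ := 0) (mem_univ _) (fun t _ => by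
        show G ((t : ℂ) + ((π / 3 : ℝ) : ℂ)) = G t
        rw [show (t : ℂ) + ((π / 3 : ℝ) : ℂ) = ((t + π / 3 : ℝ) : ℂ) by push_cast; ring, hG_real, hG_real]
        exact_mod_cast InPlanarClass.polar_add hk r t)
    exact fun z => h (mem_univ z)
  -- growth
  have hG_growth : ∀ δ : ℝ, 0 < δ → ∃ Ψ : ℝ, ∀ φ ψ : ℝ, Ψ ≤ |ψ| →
      ‖G (φ + ψ * Complex.I)‖ ≤ δ * Real.exp (6 * |ψ|) := by
    intro δ hδ
    obtain ⟨-, -, -, -, -, -, hbudget⟩ := hk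
    have hδ' : 0 < δ * (r / 2) ^ 6 := by positivity
    obtain ⟨ρ₀, hρ₀, hbud⟩ := Metric.tendsto_nhdsWithin_nhds.1 hbudget _ hδ'
    refine ⟨|Real.log (ρ₀ / r)| + 1, fun φ ψ hψ => ?_⟩
    set θ : ℂ := φ + ψ * Complex.I with hθdef
    have hθim : θ.im = ψ := by simp [hθdef]
    set j : ℤ := round (θ.re / (π / 3)) with hjdef
    have hθS : θ ∈ strip j := mem_strip_round θ
    have hc := half_lt_cos_of_mem_strip hθS
    rw [hG_eq j θ hθS]
    simp only [hGj]
    have hw : chartPt r j (shift r θ) θ ∈ fwdTube := chartPt_mem_fwdTube hr hθS (shift_le_half hr θ)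
    refine (hFb _ (shift_pos hr θ) _ hw).trans ?_
    rw [chartPt_majorant hr _ hθS, hθim]
    set s : ℝ := r * Real.cos (θ.re - j * (π / 3)) * Real.exp (-|ψ|) with hsdef
    have hs_pos : 0 < s := by positivity
    have hs_lower : r / 2 * Real.exp (-|ψ|) ≤ s := by nlinarith [Real.exp_pos (-|ψ|)]
    have hs_upper : s < ρ₀ := by
      have h1 : s ≤ r * Real.exp (-|ψ|) := by nlinarith [Real.exp_pos (-|ψ|), Real.cos_le_one (θ.re - j * (π / 3))]
      have h2 : Real.exp (-|ψ|) < ρ₀ / r := by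
        rw [← Real.exp_log (by positivity : 0 < ρ₀ / r)]
        apply Real.exp_lt_exp.2
        have := neg_abs_le (Real.log (ρ₀ / r))
        linarith
      calc s ≤ r * Real.exp (-|ψ|) := h1
        _ < r * (ρ₀ / r) := mul_lt_mul_of_pos_left h2 hr
        _ = ρ₀ := by field_simp
    have hy0 : mk2 s 0 ∈ ({0}ᶜ : Set E2) := mk2_ne_zero hs_pos.ne'
    have hnorm : ‖mk2 s 0‖ = s := by rw [norm_mk2_zero, abs_of_pos hs_pos]
    have hb := hbud hy0 (by rw [dist_zero_right, hnorm]; exact hs_upper)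
    rw [Real.dist_eq, sub_zero, hnorm, abs_mul, abs_pow, abs_of_pos hs_pos] at hb
    have hk1 : k (mk2 s 0) ≤ δ * (r / 2) ^ 6 / s ^ 6 := by
      rw [le_div_iff₀ (by positivity)]
      have := le_abs_self (k (mk2 s 0))
      nlinarith [pow_pos hs_pos 6]
    refine hk1.trans ?_
    rw [div_le_iff₀ (by positivity)]
    have h3 : (r / 2) ^ 6 ≤ (Real.exp |ψ| * s) ^ 6 := by
      refine pow_le_pow_left₀ (by positivity) ?_ 6
      have : r / 2 * Real.exp (-|ψ|) * Real.exp |ψ| ≤ s * Real.exp |ψ| :=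
        mul_le_mul_of_nonneg_right hs_lower (Real.exp_pos _).le
      rw [mul_assoc, ← Real.exp_add, neg_add_cancel, Real.exp_zero, mul_one] at this
      linarith
    calc δ * (r / 2) ^ 6 ≤ δ * (Real.exp |ψ| * s) ^ 6 := mul_le_mul_of_nonneg_left h3 hδ.le
      _ = δ * Real.exp (6 * |ψ|) * s ^ 6 := by
          rw [mul_pow, ← Real.exp_nat_mul]; push_cast; ring
  exact ⟨G, hG_diff, hG_real, hG_per, hG_growth⟩

end Summit.QuantumFields.YangMills.Cruxes.ShortRootRigidity.AngularType

end
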